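import Summits.AtomisticToContinuum.Crystallization.Theorems.FrustratedLawDichotomyStrainedPatchHomSlopePath

/-!
# The TWO-SIDED THIRD-order expansion of the per-label slope form (real side of the SECOND-ORDER centred slope leaf, K1-v2 of the sheet-tracking lever)
# (27623 `(H) HomFloor (1/625)`, hcp half; hand-1 g34 FINDING §4: the second-order remainder of the first-order centred form is the wall from `2⁻¹¹` on)

decomp-a2c hand-1 g34 (crux `AperiodicFrustratedLawGap`, stmt-AtomisticToContinuum-27623).  One Taylor order beyond `…HomSlopePath.slopeForm_secondOrder`:
for `g(s) = B(ρ_s)⟪p + s d, Δ⟫` (`ρ_s = ‖p + s d‖`, `σ = ρ′`, `τ = σ′ = (‖d‖² − σ²)/ρ`),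

  `g″ = (B₂σ² + B₁τ)·u + 2B₁σ·m`  (`u = ⟪p + s d, Δ⟫`, `m = ⟪d, Δ⟫`; `…HomSlopePath.hasDerivAt_slopeForm_deriv`),
  `g‴ = (B₃σ³ + 3B₂στ + B₁τ′)·u + 3(B₂σ² + B₁τ)·m`, `|τ′| ≤ 3‖d‖³/ρ²`, hence `|g‴| ≤ (|B₃|ρ + 6|B₂| + 6|B₁|/ρ)·‖d‖³‖Δ‖` on the tube and

  ★★★ `|g(1) − g(0) − g′(0) − g″(0)/2| ≤ (K/6)‖d‖³‖Δ‖` (`slopeForm_thirdOrder`) with the CLOSED FORM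
  `g″(0) = (B₂(‖p‖)σ₀² + B₁(‖p‖)(‖d‖² − σ₀²)/‖p‖)⟪p,Δ⟫ + 2B₁(‖p‖)σ₀⟪d,Δ⟫`, `σ₀ = ⟪p,d⟫/‖p‖`,

whenever `K ≥ |B₃ r|·r + 6|B₂ r| + 6|B₁ r|/r` on the tube (pure LJ: `B₁ = αρ`, `B₂ = α′ρ + α`, `B₃ = α″ρ + 2α′` — all three in `…HomCurvCoeff3.ljTripleFI`).
Plus the generic two-sided third-order Taylor estimate on `[0,1]` (`taylor3_lower`, `taylor3_abs`).  The second-order term `g″(0)/2` is QUADRATIC in `d`: summed over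
labels with `d_b` linear in the entry deviations it is the cross-label-combined quadratic form of the K1-v2 kernel (hand-1 g34 FINDING §4; float: `4.2e-4` vs the
first-order form's remainder bound `1.18e-2` at entry half-width `2⁻¹⁰`).

NO definitions; 0 sorry; standard axioms; no instances / notation / `#eval`.  `--supports stmt-AtomisticToContinuum-27623`.
-/

noncomputable section

namespace Summit.AtomisticToContinuum.Crystallization.Theorems.FrustratedLawDichotomyStrainedPatchHomSlopePathThird

open scoped RealInnerProductSpace
open Summit.AtomisticToContinuum.Crystallization.Theorems.FrustratedLawDichotomyStrainedPatchTaylorChord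
  (segR segN segS segN_eq_inner hasDerivAt_segR hasDerivAt_segS segS_sq_le)
open Summit.AtomisticToContinuum.Crystallization.Theorems.FrustratedLawDichotomyStrainedPatchHomConvexSegment (le_of_deriv_nonneg_piece)
open Summit.AtomisticToContinuum.Crystallization.Theorems.FrustratedLawDichotomyStrainedPatchHomHessPath
  (inner_path_eq hasDerivAt_inner_path abs_segS_le segS_deriv_eq segS_deriv_bounds)
open Summit.AtomisticToContinuum.Crystallization.Theorems.FrustratedLawDichotomyStrainedPatchHomSlopePath
  (taylor2_lower hasDerivAt_slopeForm hasDerivAt_slopeForm_deriv)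

/-! ## §1. Generic two-sided third-order Taylor estimate on `[0,1]` -/

/-- ★ One-sided: `g′ = g1`, `g1′ = g2`, `g2′ = g3 ≥ −L` on `[0,1]` ⟹ `g 0 + g1 0 + g2 0/2 − L/6 ≤ g 1`. [folklore: monotonicity thrice] -/
theorem taylor3_lower {g g1 g2 g3 : ℝ → ℝ} {L : ℝ}
    (hd1 : ∀ t ∈ Set.Icc (0 : ℝ) 1, HasDerivAt g (g1 t) t) (hd2 : ∀ t ∈ Set.Icc (0 : ℝ) 1, HasDerivAt g1 (g2 t) t)
    (hd3 : ∀ t ∈ Set.Icc (0 : ℝ) 1, HasDerivAt g2 (g3 t) t) (hfl : ∀ t ∈ Set.Icc (0 : ℝ) 1, -L ≤ g3 t) :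
    g 0 + g1 0 + g2 0 / 2 - L / 6 ≤ g 1 := by
  -- step 1 (from `taylor2_lower` on `g1` restricted to `[0,t]` by rescaling is awkward; do it directly): `g2 0 ≤ g2 t + L t`
  have hψ : ∀ t ∈ Set.Icc (0 : ℝ) 1, g2 0 ≤ g2 t + L * t := by
    intro t ht
    have hsub : ∀ s ∈ Set.Icc (0 : ℝ) t, s ∈ Set.Icc (0 : ℝ) 1 := fun s hs => ⟨hs.1, hs.2.trans ht.2⟩
    have hder : ∀ s ∈ Set.Icc (0 : ℝ) t, HasDerivAt (fun x => g2 x + L * x) (g3 s + L) s := fun s hs =>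
      ((hd3 s (hsub s hs)).add ((hasDerivAt_id' s).const_mul L)).congr_deriv (by ring)
    have hcont : ContinuousOn (fun x => g2 x + L * x) (Set.Icc 0 t) := fun s hs => (hder s hs).continuousAt.continuousWithinAt
    have key := le_of_deriv_nonneg_piece ht.1 hcont (fun s hs => hder s (Set.Ioo_subset_Icc_self hs))
      (fun s hs => by linarith [hfl s (hsub s (Set.Ioo_subset_Icc_self hs))])
    simpa using key
  -- step 2: `g1 t ≥ g1 0 + t g2 0 − L t²/2`
  have hφ : ∀ t ∈ Set.Icc (0 : ℝ) 1, g1 0 + g2 0 * t - L / 2 * (t * t) ≤ g1 t := by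
    intro t ht
    have hsub : ∀ s ∈ Set.Icc (0 : ℝ) t, s ∈ Set.Icc (0 : ℝ) 1 := fun s hs => ⟨hs.1, hs.2.trans ht.2⟩
    have hder : ∀ s ∈ Set.Icc (0 : ℝ) t, HasDerivAt (fun x => g1 x - g2 0 * x + L / 2 * (x * x)) (g2 s - g2 0 + L * s) s := by
      intro s hs
      have h := ((hd2 s (hsub s hs)).sub ((hasDerivAt_id' s).const_mul (g2 0))).add (((hasDerivAt_id' s).mul (hasDerivAt_id' s)).const_mul (L / 2))
      exact h.congr_deriv (by ring)
    have hcont : ContinuousOn (fun x => g1 x - g2 0 * x + L / 2 * (x * x)) (Set.Icc 0 t) := fun s hs => (hder s hs).continuousAt.continuousWithinAt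
    have key := le_of_deriv_nonneg_piece ht.1 hcont (fun s hs => hder s (Set.Ioo_subset_Icc_self hs))
      (fun s hs => by linarith [hψ s (hsub s (Set.Ioo_subset_Icc_self hs))])
    simp only [mul_zero, sub_zero, add_zero] at key
    linarith
  -- step 3: `Φ = g − g1 0·t − g2 0·t²/2 + L t³/6` is non-decreasing on `[0,1]`
  have hΦder : ∀ t ∈ Set.Icc (0 : ℝ) 1, HasDerivAt (fun x => g x - g1 0 * x - g2 0 / 2 * (x * x) + L / 6 * (x * x * x))
      (g1 t - g1 0 - g2 0 * t + L / 2 * (t * t)) t := by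
    intro t ht
    have h3 : HasDerivAt (fun x : ℝ => x * x * x) (t * t + t * t + t * t) t := by
      have := ((hasDerivAt_id' t).mul (hasDerivAt_id' t)).mul (hasDerivAt_id' t)
      exact this.congr_deriv (by simp; ring)
    have h := (((hd1 t ht).sub ((hasDerivAt_id' t).const_mul (g1 0))).sub (((hasDerivAt_id' t).mul (hasDerivAt_id' t)).const_mul (g2 0 / 2))).add
      (h3.const_mul (L / 6))
    exact h.congr_deriv (by simp; ring)
  have hΦcont : ContinuousOn (fun x => g x - g1 0 * x - g2 0 / 2 * (x * x) + L / 6 * (x * x * x)) (Set.Icc 0 1) :=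
    fun s hs => (hΦder s hs).continuousAt.continuousWithinAt
  have hΦ := le_of_deriv_nonneg_piece zero_le_one hΦcont (fun s hs => hΦder s (Set.Ioo_subset_Icc_self hs))
    (fun s hs => by linarith [hφ s (Set.Ioo_subset_Icc_self hs)])
  simp only [mul_zero, sub_zero, add_zero, mul_one] at hΦ
  linarith

/-- ★ Two-sided: `|g3| ≤ L` on `[0,1]` ⟹ `|g 1 − g 0 − g1 0 − g2 0/2| ≤ L/6`. [folklore] -/
theorem taylor3_abs {g g1 g2 g3 : ℝ → ℝ} {L : ℝ}
    (hd1 : ∀ t ∈ Set.Icc (0 : ℝ) 1, HasDerivAt g (g1 t) t) (hd2 : ∀ t ∈ Set.Icc (0 : ℝ) 1, HasDerivAt g1 (g2 t) t)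
    (hd3 : ∀ t ∈ Set.Icc (0 : ℝ) 1, HasDerivAt g2 (g3 t) t) (hbd : ∀ t ∈ Set.Icc (0 : ℝ) 1, |g3 t| ≤ L) :
    |g 1 - g 0 - g1 0 - g2 0 / 2| ≤ L / 6 := by
  have h1 := taylor3_lower hd1 hd2 hd3 (fun t ht => by linarith [(abs_le.1 (hbd t ht)).1])
  have h2 := taylor3_lower (g := fun t => -g t) (g1 := fun t => -g1 t) (g2 := fun t => -g2 t) (g3 := fun t => -g3 t) (L := L)
    (fun t ht => (hd1 t ht).neg) (fun t ht => (hd2 t ht).neg) (fun t ht => (hd3 t ht).neg) (fun t ht => by linarith [(abs_le.1 (hbd t ht)).2])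
  exact abs_le.2 ⟨by linarith, by linarith⟩

/-! ## §2. The third derivative of the slope form -/

/-- `τ = σ′ = (‖d‖² − σ²)/ρ` as a function of the path parameter. -/
theorem hasDerivAt_tau {p d : EuclideanSpace ℝ (Fin 3)} {t : ℝ} (h0 : segR p d t ≠ 0) :
    HasDerivAt (fun s : ℝ => (‖d‖ ^ 2 - segS p d s ^ 2) / segR p d s)
      ((-(2 * segS p d t * ((‖d‖ ^ 2 * segR p d t - segN p d t * segS p d t) / segR p d t ^ 2)) * segR p d t -
        (‖d‖ ^ 2 - segS p d t ^ 2) * segS p d t) / segR p d t ^ 2) t := by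
  have hσ := hasDerivAt_segS (p := p) (Δ := d) h0
  have hρ := hasDerivAt_segR (p := p) (Δ := d) h0
  have hf : HasDerivAt (fun s : ℝ => ‖d‖ ^ 2 - segS p d s ^ 2)
      (-(2 * segS p d t * ((‖d‖ ^ 2 * segR p d t - segN p d t * segS p d t) / segR p d t ^ 2))) t := by
    have := (hσ.pow 2).const_sub (‖d‖ ^ 2)
    exact this.congr_deriv (by simp)
  exact (hf.div hρ h0).congr_deriv rfl

/-- ★ `|τ′| ≤ 3‖d‖³/ρ²` on the tube. [folklore: `|σ| ≤ ‖d‖`, `0 ≤ σ′ ≤ ‖d‖²/ρ`, `0 ≤ ‖d‖² − σ² ≤ ‖d‖²`] -/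
theorem abs_tau_deriv_le {p d : EuclideanSpace ℝ (Fin 3)} {t : ℝ} (h0 : 0 < segR p d t) :
    |(-(2 * segS p d t * ((‖d‖ ^ 2 * segR p d t - segN p d t * segS p d t) / segR p d t ^ 2)) * segR p d t -
        (‖d‖ ^ 2 - segS p d t ^ 2) * segS p d t) / segR p d t ^ 2| ≤ 3 * ‖d‖ ^ 3 / segR p d t ^ 2 := by
  set ρ := segR p d t with hρ
  set σ := segS p d t with hσ
  set τ := (‖d‖ ^ 2 * segR p d t - segN p d t * segS p d t) / segR p d t ^ 2 with hτ
  have hτb := segS_deriv_bounds (p := p) (d := d) h0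
  rw [← hτ, ← hρ] at hτb
  have hσ2 : σ ^ 2 ≤ ‖d‖ ^ 2 := segS_sq_le h0
  have hσa : |σ| ≤ ‖d‖ := abs_le_of_sq_le_sq (by simpa using hσ2) (norm_nonneg d)
  have hnd : 0 ≤ ‖d‖ := norm_nonneg d
  rw [abs_div, abs_of_pos (pow_pos h0 2), div_le_div_iff_of_pos_right (pow_pos h0 2)]
  have h1 : |(-(2 * σ * τ)) * ρ| ≤ 2 * ‖d‖ ^ 3 := by
    rw [abs_mul, abs_neg, abs_mul, abs_mul, abs_of_pos h0, abs_of_nonneg hτb.1, abs_of_pos (by norm_num : (0:ℝ) < 2)]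
    calc 2 * |σ| * τ * ρ ≤ 2 * ‖d‖ * (‖d‖ ^ 2 / ρ) * ρ := by
          have h' := mul_le_mul (mul_le_mul_of_nonneg_left hσa (by norm_num : (0:ℝ) ≤ 2)) hτb.2 hτb.1 (by positivity)
          exact mul_le_mul_of_nonneg_right h' h0.le
      _ = 2 * ‖d‖ ^ 3 := by field_simp
  have h2 : |(‖d‖ ^ 2 - σ ^ 2) * σ| ≤ ‖d‖ ^ 3 := by
    rw [abs_mul, abs_of_nonneg (by linarith : (0:ℝ) ≤ ‖d‖ ^ 2 - σ ^ 2)]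
    calc (‖d‖ ^ 2 - σ ^ 2) * |σ| ≤ ‖d‖ ^ 2 * ‖d‖ := mul_le_mul (by nlinarith [sq_nonneg σ]) hσa (abs_nonneg _) (by positivity)
      _ = ‖d‖ ^ 3 := by ring
  calc |(-(2 * σ * τ)) * ρ - (‖d‖ ^ 2 - σ ^ 2) * σ| ≤ |(-(2 * σ * τ)) * ρ| + |(‖d‖ ^ 2 - σ ^ 2) * σ| := abs_sub _ _
    _ ≤ 2 * ‖d‖ ^ 3 + ‖d‖ ^ 3 := add_le_add h1 h2
    _ = 3 * ‖d‖ ^ 3 := by ring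

/-- ★ Third derivative: `g‴ = (B₃σ³ + 3B₂στ + B₁τ′)·u + 3(B₂σ² + B₁τ)·m`. [folklore: chain and product rules] -/
theorem hasDerivAt_slopeForm_deriv2 {B₁ B₂ B₃ : ℝ → ℝ} {p d Δ : EuclideanSpace ℝ (Fin 3)} {t : ℝ} (h0 : segR p d t ≠ 0)
    (hB₁ : HasDerivAt B₁ (B₂ (segR p d t)) (segR p d t)) (hB₂ : HasDerivAt B₂ (B₃ (segR p d t)) (segR p d t)) :
    HasDerivAt (fun s : ℝ => (B₂ (segR p d s) * segS p d s ^ 2 + B₁ (segR p d s) * ((‖d‖ ^ 2 - segS p d s ^ 2) / segR p d s)) *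
          ⟪p + s • d, Δ⟫ + 2 * B₁ (segR p d s) * segS p d s * ⟪d, Δ⟫)
      ((B₃ (segR p d t) * segS p d t ^ 3 + 3 * B₂ (segR p d t) * segS p d t * ((‖d‖ ^ 2 * segR p d t - segN p d t * segS p d t) / segR p d t ^ 2) +
          B₁ (segR p d t) * ((-(2 * segS p d t * ((‖d‖ ^ 2 * segR p d t - segN p d t * segS p d t) / segR p d t ^ 2)) * segR p d t -
            (‖d‖ ^ 2 - segS p d t ^ 2) * segS p d t) / segR p d t ^ 2)) * ⟪p + t • d, Δ⟫ +
        (B₂ (segR p d t) * segS p d t ^ 2 + B₁ (segR p d t) * ((‖d‖ ^ 2 - segS p d t ^ 2) / segR p d t)) * ⟪d, Δ⟫ +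
        2 * (B₂ (segR p d t) * segS p d t * segS p d t +
          B₁ (segR p d t) * ((‖d‖ ^ 2 * segR p d t - segN p d t * segS p d t) / segR p d t ^ 2)) * ⟪d, Δ⟫) t := by
  have hρ := hasDerivAt_segR (p := p) (Δ := d) h0
  have hσ := hasDerivAt_segS (p := p) (Δ := d) h0
  have hτ := hasDerivAt_tau (p := p) (d := d) h0
  have hB₁c : HasDerivAt (fun s => B₁ (segR p d s)) (B₂ (segR p d t) * segS p d t) t := hB₁.comp t hρ
  have hB₂c : HasDerivAt (fun s => B₂ (segR p d s)) (B₃ (segR p d t) * segS p d t) t := hB₂.comp t hρ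
  have hu := hasDerivAt_inner_path p d Δ t
  have hA : HasDerivAt (fun s => B₂ (segR p d s) * segS p d s ^ 2 + B₁ (segR p d s) * ((‖d‖ ^ 2 - segS p d s ^ 2) / segR p d s))
      (B₃ (segR p d t) * segS p d t * segS p d t ^ 2 + B₂ (segR p d t) * (2 * segS p d t * ((‖d‖ ^ 2 * segR p d t - segN p d t * segS p d t) / segR p d t ^ 2)) +
        (B₂ (segR p d t) * segS p d t * ((‖d‖ ^ 2 - segS p d t ^ 2) / segR p d t) +
          B₁ (segR p d t) * ((-(2 * segS p d t * ((‖d‖ ^ 2 * segR p d t - segN p d t * segS p d t) / segR p d t ^ 2)) * segR p d t -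
            (‖d‖ ^ 2 - segS p d t ^ 2) * segS p d t) / segR p d t ^ 2))) t := by
    have h1 := hB₂c.mul (hσ.pow 2)
    have h2 := hB₁c.mul hτ
    exact (h1.add h2).congr_deriv (by simp)
  have h1 := hA.mul hu
  have h2 := ((hB₁c.mul hσ).const_mul 2).mul_const ⟪d, Δ⟫
  have e : (fun s : ℝ => (B₂ (segR p d s) * segS p d s ^ 2 + B₁ (segR p d s) * ((‖d‖ ^ 2 - segS p d s ^ 2) / segR p d s)) *
          ⟪p + s • d, Δ⟫ + 2 * B₁ (segR p d s) * segS p d s * ⟪d, Δ⟫) =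
      fun s => (B₂ (segR p d s) * segS p d s ^ 2 + B₁ (segR p d s) * ((‖d‖ ^ 2 - segS p d s ^ 2) / segR p d s)) * ⟪p + s • d, Δ⟫ +
        2 * (B₁ (segR p d s) * segS p d s) * ⟪d, Δ⟫ := by
    funext s; ring
  rw [e]
  refine (h1.add h2).congr_deriv ?_
  have eτ := segS_deriv_eq (p := p) (d := d) h0
  rw [← eτ]
  ring

/-! ## §3. The pointwise bound of `g‴` -/

/-- ★ **Pointwise bound of the third derivative**: `|σ| ≤ nd`, `0 ≤ τ ≤ nd²/ρ`, `|τ′| ≤ 3nd³/ρ²`, `|u| ≤ ρ nΔ`, `|m| ≤ nd nΔ`,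
`|B3|ρ + 6|B2| + 6|B1|/ρ ≤ K` ⟹ `|(B3σ³ + 3B2στ + B1τ′)u + (B2σ²+B1τ)m + 2(B2σσ + B1τ)m| ≤ K nd³ nΔ`. [folklore] -/
theorem thirdDeriv_abs_le {B1 B2 B3 K ρ σ τ τ' u m nd nΔ : ℝ} (hρ : 0 < ρ) (hnd : 0 ≤ nd) (hnΔ : 0 ≤ nΔ)
    (hσ : σ ^ 2 ≤ nd ^ 2) (hτ0 : 0 ≤ τ) (hτ : τ ≤ nd ^ 2 / ρ) (hτ' : |τ'| ≤ 3 * nd ^ 3 / ρ ^ 2) (hu : |u| ≤ ρ * nΔ) (hm : |m| ≤ nd * nΔ)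
    (hK : |B3| * ρ + 6 * |B2| + 6 * |B1| / ρ ≤ K) :
    |(B3 * σ ^ 3 + 3 * B2 * σ * τ + B1 * τ') * u + (B2 * σ ^ 2 + B1 * τ) * m + 2 * (B2 * σ * σ + B1 * τ) * m| ≤ K * nd ^ 3 * nΔ := by
  have hσa : |σ| ≤ nd := abs_le_of_sq_le_sq hσ hnd
  have hσ3 : |σ ^ 3| ≤ nd ^ 3 := by rw [abs_pow]; exact pow_le_pow_left₀ (abs_nonneg _) hσa 3
  have hσ2 : |σ ^ 2| ≤ nd ^ 2 := by rw [abs_pow]; exact pow_le_pow_left₀ (abs_nonneg _) hσa 2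
  have W : 0 ≤ nd ^ 3 * nΔ := by positivity
  have h1 : |B3 * σ ^ 3 * u| ≤ |B3| * ρ * (nd ^ 3 * nΔ) := by
    rw [abs_mul, abs_mul]
    calc |B3| * |σ ^ 3| * |u| ≤ |B3| * nd ^ 3 * (ρ * nΔ) := mul_le_mul (mul_le_mul_of_nonneg_left hσ3 (abs_nonneg _)) hu (abs_nonneg _) (by positivity)
      _ = |B3| * ρ * (nd ^ 3 * nΔ) := by ring
  have h2 : |3 * B2 * σ * τ * u| ≤ 3 * |B2| * (nd ^ 3 * nΔ) := by
    rw [abs_mul, abs_mul, abs_mul, abs_mul, abs_of_pos (by norm_num : (0:ℝ) < 3), abs_of_nonneg hτ0]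
    calc 3 * |B2| * |σ| * τ * |u| ≤ 3 * |B2| * nd * (nd ^ 2 / ρ) * (ρ * nΔ) := by gcongr
      _ = 3 * |B2| * (nd ^ 3 * nΔ) := by field_simp
  have h3 : |B1 * τ' * u| ≤ 3 * |B1| / ρ * (nd ^ 3 * nΔ) := by
    rw [abs_mul, abs_mul]
    calc |B1| * |τ'| * |u| ≤ |B1| * (3 * nd ^ 3 / ρ ^ 2) * (ρ * nΔ) := by gcongr
      _ = 3 * |B1| / ρ * (nd ^ 3 * nΔ) := by field_simp
  have h4 : |(B2 * σ ^ 2 + B1 * τ) * m| ≤ (|B2| + |B1| / ρ) * (nd ^ 3 * nΔ) := by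
    rw [abs_mul]
    have ha : |B2 * σ ^ 2 + B1 * τ| ≤ |B2| * nd ^ 2 + |B1| * (nd ^ 2 / ρ) := by
      calc |B2 * σ ^ 2 + B1 * τ| ≤ |B2 * σ ^ 2| + |B1 * τ| := abs_add_le _ _
        _ ≤ |B2| * nd ^ 2 + |B1| * (nd ^ 2 / ρ) := by
          rw [abs_mul, abs_mul, abs_of_nonneg hτ0]
          exact add_le_add (mul_le_mul_of_nonneg_left hσ2 (abs_nonneg _)) (mul_le_mul_of_nonneg_left hτ (abs_nonneg _))
    calc |B2 * σ ^ 2 + B1 * τ| * |m| ≤ (|B2| * nd ^ 2 + |B1| * (nd ^ 2 / ρ)) * (nd * nΔ) := mul_le_mul ha hm (abs_nonneg _) (by positivity)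
      _ = (|B2| + |B1| / ρ) * (nd ^ 3 * nΔ) := by field_simp
  have h5 : |2 * (B2 * σ * σ + B1 * τ) * m| ≤ 2 * (|B2| + |B1| / ρ) * (nd ^ 3 * nΔ) := by
    have e : B2 * σ * σ + B1 * τ = B2 * σ ^ 2 + B1 * τ := by ring
    rw [e, mul_assoc, abs_mul, abs_of_pos (by norm_num : (0:ℝ) < 2), mul_assoc]
    exact mul_le_mul_of_nonneg_left h4 (by norm_num)
  have hsplit : (B3 * σ ^ 3 + 3 * B2 * σ * τ + B1 * τ') * u = B3 * σ ^ 3 * u + 3 * B2 * σ * τ * u + B1 * τ' * u := by ring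
  rw [hsplit]
  calc |B3 * σ ^ 3 * u + 3 * B2 * σ * τ * u + B1 * τ' * u + (B2 * σ ^ 2 + B1 * τ) * m + 2 * (B2 * σ * σ + B1 * τ) * m|
      ≤ |B3 * σ ^ 3 * u + 3 * B2 * σ * τ * u + B1 * τ' * u| + |(B2 * σ ^ 2 + B1 * τ) * m| + |2 * (B2 * σ * σ + B1 * τ) * m| := abs_add_three _ _ _
    _ ≤ (|B3 * σ ^ 3 * u| + |3 * B2 * σ * τ * u| + |B1 * τ' * u|) + |(B2 * σ ^ 2 + B1 * τ) * m| + |2 * (B2 * σ * σ + B1 * τ) * m| := by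
        gcongr; exact abs_add_three _ _ _
    _ ≤ (|B3| * ρ * (nd ^ 3 * nΔ) + 3 * |B2| * (nd ^ 3 * nΔ) + 3 * |B1| / ρ * (nd ^ 3 * nΔ)) + (|B2| + |B1| / ρ) * (nd ^ 3 * nΔ) +
        2 * (|B2| + |B1| / ρ) * (nd ^ 3 * nΔ) := by linarith
    _ = (|B3| * ρ + 6 * |B2| + 6 * |B1| / ρ) * (nd ^ 3 * nΔ) := by ring
    _ ≤ K * (nd ^ 3 * nΔ) := mul_le_mul_of_nonneg_right hK W
    _ = K * nd ^ 3 * nΔ := by ring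

/-! ## §4. ★★★ The two-sided third-order expansion of the slope form -/

/-- ★★★ **TWO-SIDED THIRD-ORDER EXPANSION OF THE PER-LABEL SLOPE FORM.**  Tube `a < ‖p + t d‖ < b` for `t ∈ [0,1]` (`a > 0`); on `(a, b)`: `B′ = B₁`,
`B₁′ = B₂`, `B₂′ = B₃` and `|B₃ r|·r + 6|B₂ r| + 6|B₁ r|/r ≤ K`.  Then, with `σ₀ = ⟪p,d⟫/‖p‖`,
`|B(‖p+d‖)⟪p+d,Δ⟫ − B(‖p‖)⟪p,Δ⟫ − (B₁(‖p‖)σ₀⟪p,Δ⟫ + B(‖p‖)⟪d,Δ⟫) − ((B₂(‖p‖)σ₀² + B₁(‖p‖)(‖d‖² − σ₀²)/‖p‖)⟪p,Δ⟫ + 2B₁(‖p‖)σ₀⟪d,Δ⟫)/2| ≤ (K/6)‖d‖³‖Δ‖`.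
[folklore: Taylor with third-order remainder] -/
theorem slopeForm_thirdOrder {B B₁ B₂ B₃ : ℝ → ℝ} {a b K : ℝ} {p d Δ : EuclideanSpace ℝ (Fin 3)} (ha : 0 < a)
    (htube : ∀ t ∈ Set.Icc (0 : ℝ) 1, a < segR p d t ∧ segR p d t < b)
    (hB : ∀ r, a < r → r < b → HasDerivAt B (B₁ r) r) (hB₁ : ∀ r, a < r → r < b → HasDerivAt B₁ (B₂ r) r)
    (hB₂ : ∀ r, a < r → r < b → HasDerivAt B₂ (B₃ r) r)
    (hK : ∀ r, a < r → r < b → |B₃ r| * r + 6 * |B₂ r| + 6 * |B₁ r| / r ≤ K) :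
    |B ‖p + d‖ * ⟪p + d, Δ⟫ - B ‖p‖ * ⟪p, Δ⟫ - (B₁ ‖p‖ * (⟪p, d⟫ / ‖p‖) * ⟪p, Δ⟫ + B ‖p‖ * ⟪d, Δ⟫) -
        ((B₂ ‖p‖ * (⟪p, d⟫ / ‖p‖) ^ 2 + B₁ ‖p‖ * ((‖d‖ ^ 2 - (⟪p, d⟫ / ‖p‖) ^ 2) / ‖p‖)) * ⟪p, Δ⟫ + 2 * B₁ ‖p‖ * (⟪p, d⟫ / ‖p‖) * ⟪d, Δ⟫) / 2| ≤
      K / 6 * ‖d‖ ^ 3 * ‖Δ‖ := by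
  set g : ℝ → ℝ := fun s => B (segR p d s) * ⟪p + s • d, Δ⟫ with hg
  set g1 : ℝ → ℝ := fun s => B₁ (segR p d s) * segS p d s * ⟪p + s • d, Δ⟫ + B (segR p d s) * ⟪d, Δ⟫ with hg1
  set g2 : ℝ → ℝ := fun s =>
    (B₂ (segR p d s) * segS p d s ^ 2 + B₁ (segR p d s) * ((‖d‖ ^ 2 - segS p d s ^ 2) / segR p d s)) * ⟪p + s • d, Δ⟫ +
      2 * B₁ (segR p d s) * segS p d s * ⟪d, Δ⟫ with hg2
  set g3 : ℝ → ℝ := fun t =>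
    (B₃ (segR p d t) * segS p d t ^ 3 + 3 * B₂ (segR p d t) * segS p d t * ((‖d‖ ^ 2 * segR p d t - segN p d t * segS p d t) / segR p d t ^ 2) +
          B₁ (segR p d t) * ((-(2 * segS p d t * ((‖d‖ ^ 2 * segR p d t - segN p d t * segS p d t) / segR p d t ^ 2)) * segR p d t -
            (‖d‖ ^ 2 - segS p d t ^ 2) * segS p d t) / segR p d t ^ 2)) * ⟪p + t • d, Δ⟫ +
        (B₂ (segR p d t) * segS p d t ^ 2 + B₁ (segR p d t) * ((‖d‖ ^ 2 - segS p d t ^ 2) / segR p d t)) * ⟪d, Δ⟫ +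
        2 * (B₂ (segR p d t) * segS p d t * segS p d t +
          B₁ (segR p d t) * ((‖d‖ ^ 2 * segR p d t - segN p d t * segS p d t) / segR p d t ^ 2)) * ⟪d, Δ⟫ with hg3
  set L : ℝ := K * ‖d‖ ^ 3 * ‖Δ‖ with hL
  have hpos : ∀ t ∈ Set.Icc (0 : ℝ) 1, 0 < segR p d t := fun t ht => ha.trans (htube t ht).1
  have hd1 : ∀ t ∈ Set.Icc (0 : ℝ) 1, HasDerivAt g (g1 t) t := fun t ht =>
    hasDerivAt_slopeForm (hpos t ht).ne' (hB _ (htube t ht).1 (htube t ht).2)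
  have hd2 : ∀ t ∈ Set.Icc (0 : ℝ) 1, HasDerivAt g1 (g2 t) t := by
    intro t ht
    have h := hasDerivAt_slopeForm_deriv (Δ := Δ) (hpos t ht).ne' (hB _ (htube t ht).1 (htube t ht).2) (hB₁ _ (htube t ht).1 (htube t ht).2)
    refine h.congr_deriv ?_
    rw [hg2]
    simp only []
    rw [segS_deriv_eq (hpos t ht).ne']
  have hd3 : ∀ t ∈ Set.Icc (0 : ℝ) 1, HasDerivAt g2 (g3 t) t := fun t ht =>
    hasDerivAt_slopeForm_deriv2 (hpos t ht).ne' (hB₁ _ (htube t ht).1 (htube t ht).2) (hB₂ _ (htube t ht).1 (htube t ht).2)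
  have hbd : ∀ t ∈ Set.Icc (0 : ℝ) 1, |g3 t| ≤ L := by
    intro t ht
    have h0 := hpos t ht
    have hτ := segS_deriv_bounds (p := p) (d := d) h0
    have hτe := segS_deriv_eq (p := p) (d := d) h0.ne'
    have hu : |⟪p + t • d, Δ⟫| ≤ segR p d t * ‖Δ‖ := by rw [segR]; exact abs_real_inner_le_norm _ _
    have hm : |⟪d, Δ⟫| ≤ ‖d‖ * ‖Δ‖ := abs_real_inner_le_norm _ _
    have key := thirdDeriv_abs_le (B1 := B₁ (segR p d t)) (B2 := B₂ (segR p d t)) (B3 := B₃ (segR p d t))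
      h0 (norm_nonneg d) (norm_nonneg Δ) (segS_sq_le h0) hτ.1 hτ.2 (abs_tau_deriv_le (p := p) (d := d) h0) hu hm
      (hK _ (htube t ht).1 (htube t ht).2)
    rw [hg3]
    simp only []
    rw [← hτe]
    have e3 : segS p d t ^ 3 = segS p d t ^ 3 := rfl
    convert key using 2
  have key := taylor3_abs hd1 hd2 hd3 hbd
  have hR0 : segR p d 0 = ‖p‖ := by simp [segR]
  have hR1 : segR p d 1 = ‖p + d‖ := by simp [segR]
  have hS0 : segS p d 0 = ⟪p, d⟫ / ‖p‖ := by simp [segS, segN, segR]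
  have hg0 : g 0 = B ‖p‖ * ⟪p, Δ⟫ := by simp [hg, hR0]
  have hgone : g 1 = B ‖p + d‖ * ⟪p + d, Δ⟫ := by simp [hg, hR1]
  have hg10 : g1 0 = B₁ ‖p‖ * (⟪p, d⟫ / ‖p‖) * ⟪p, Δ⟫ + B ‖p‖ * ⟪d, Δ⟫ := by simp [hg1, hR0, hS0]
  have hg20 : g2 0 = (B₂ ‖p‖ * (⟪p, d⟫ / ‖p‖) ^ 2 + B₁ ‖p‖ * ((‖d‖ ^ 2 - (⟪p, d⟫ / ‖p‖) ^ 2) / ‖p‖)) * ⟪p, Δ⟫ +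
      2 * B₁ ‖p‖ * (⟪p, d⟫ / ‖p‖) * ⟪d, Δ⟫ := by simp [hg2, hR0, hS0]
  rw [hg0, hgone, hg10, hg20, hL] at key
  have e : K * ‖d‖ ^ 3 * ‖Δ‖ / 6 = K / 6 * ‖d‖ ^ 3 * ‖Δ‖ := by ring
  rw [e] at key
  exact key

end Summit.AtomisticToContinuum.Crystallization.Theorems.FrustratedLawDichotomyStrainedPatchHomSlopePathThird

end
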